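import Summits.NavierStokesRegularity.NavierStokesRegularity.Theorems.PerpetualPumpCircuitPumpActiveCoreShift
import Literature.Analysis.ODE.OneSidedComparison

/-!
# Active block of the Toda pump: global brackets on any short window
# (crux `PerpetualPump.CircuitPump`, stmt-NavierStokesRegularity-1834; line `singular-clock-gspt`,
# sub-goal `toda_active_brackets` of `stub_clockBox`, Toda `m = 2` instance)

The four active modes `(u, v, w, z)` of the seeded graded Toda pump in raw units at the active
scale (`u' = −u − v² + e²/lam − εuv`, `v' = v(u − w) − v + εu²`,
`w' = −νw + v² − lam z² − ε lam w z`, `z' = z(lam(w − y) − ν) + ε lam w²`, `ν = lam^{4/5}`,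
`0 ≤ e ≤ 1`, `|y| ≤ 1`, `z ≤ 1` given; section data `u(0) = A`, `v(0) = √ε`,
`w(0) ∈ [−ε², ε^{3/4}]`, `z(0) ∈ [0, ε^{3/2}]`) on ANY window `[0, T]`, `0 < T ≤ 1/2` — no lower
bound on `T`. The global brackets `0 ≤ v ≤ A + 3`, `−13 ≤ u ≤ A + 3`, `−2 ≤ w ≤ A + 3`, `z ≥ 0`,
`R = √((u − w)² + 2v²) ≥ A/4` use only: `z, v ≥ 0` (linear comparison with non-negative sources),
the energy `E = u² + v² + w²` whose derivative has no cubic terms (`shift_pt_energy`, so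
`|u|, v, |w| ≤ A + 1` and the perturbation sizes `shift_pt_pert`), and the `σ`-gate lemma
`toda_gate_sigma` for the SHIFTED carrier `W = w + ε² e^{−νt}` (`W(0) ∈ [0, 1]`, `P = 3`) with the
pointwise consequences `period_pt_apriori`, translated back by `|w − W| ≤ ε²` and the `1`-Lipschitz
bound `gate_sqrt_shift_le`. The new bond obeys the crude Grönwall bound
`z ≤ (ε^{3/2} + ε lam (A + 3)² t) e^{lam (A + 4) t}` from `z' ≤ lam (A + 4) z + ε lam (A + 3)²`
(`w ≤ A + 3`, `−y ≤ 1`, `z ≥ 0`; Mathlib's `gronwallBound`). [folklore]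
-/

noncomputable section

-- the summit namespace `…NavierStokesRegularity.NavierStokesRegularity…` is the tree convention
set_option linter.dupNamespace false

namespace Summit.NavierStokesRegularity.NavierStokesRegularity.Theorems.PerpetualPumpCircuitPump

open Set Filter Topology Literature.Analysis.ODE

/-- **Crude Grönwall bound for the new bond.** If `z ≥ 0` solves
`z' = z(lam(w − y) − ν) + ε lam w²` on `[0, T)` with `|w| ≤ A + 3`, `|y| ≤ 1`, `lam, ν, ε ≥ 0`, then
`z' ≤ lam (A + 4) z + ε lam (A + 3)²`, so `z(t) ≤ (z(0) + ε lam (A + 3)² t) e^{lam (A + 4) t}`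
(Mathlib's `gronwallBound` and `gronwallBound_le_mul_exp`). [folklore] -/
theorem brackets_z_gronwall {lam ν ε A T z0 : ℝ} {w z y : ℝ → ℝ} (hlam : 0 ≤ lam) (hν : 0 ≤ ν)
    (hε : 0 ≤ ε) (hA : 0 ≤ A + 3) (hz : ContinuousOn z (Icc 0 T))
    (hz' : ∀ t ∈ Ico 0 T, HasDerivWithinAt z
      (z t * (lam * (w t - y t) - ν) + ε * lam * w t ^ 2) (Ici t) t)
    (hy : ∀ t ∈ Icc 0 T, |y t| ≤ 1) (hw : ∀ t ∈ Icc 0 T, |w t| ≤ A + 3)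
    (hzp : ∀ t ∈ Icc 0 T, 0 ≤ z t) (hz0 : z 0 ≤ z0) :
    ∀ t ∈ Icc 0 T, z t ≤ (z0 + ε * lam * (A + 3) ^ 2 * t) * Real.exp (lam * (A + 4) * t) := by
  intro t ht
  have h := le_gronwallBound_of_deriv_right_le (α := ε * lam * (A + 3) ^ 2) (β := lam * (A + 4))
    hz hz' (fun x hx => by
      have hx' := Ico_subset_Icc_self hx
      obtain ⟨hy1, -⟩ := abs_le.mp (hy x hx')
      obtain ⟨hw1, hw2⟩ := abs_le.mp (hw x hx')
      have hzx := hzp x hx'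
      have h1 : lam * (w x - y x) - ν ≤ lam * (A + 4) := by
        have := mul_le_mul_of_nonneg_left (by linarith only [hy1, hw2] : w x - y x ≤ A + 4) hlam
        linarith only [this, hν]
      have h2 : z x * (lam * (w x - y x) - ν) ≤ z x * (lam * (A + 4)) :=
        mul_le_mul_of_nonneg_left h1 hzx
      have h3 : w x ^ 2 ≤ (A + 3) ^ 2 := by nlinarith only [hw1, hw2]
      have h4 : ε * lam * w x ^ 2 ≤ ε * lam * (A + 3) ^ 2 :=
        mul_le_mul_of_nonneg_left h3 (mul_nonneg hε hlam)
      linarith only [h2, h4]) t ht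
  have h2 := gronwallBound_le_mul_exp (δ := z 0) (K := lam * (A + 4)) (ε := ε * lam * (A + 3) ^ 2)
    (x := t - 0) (by positivity) (by nlinarith only [hlam, hA])
  rw [sub_zero] at h h2
  have h3 : (z 0 + ε * lam * (A + 3) ^ 2 * t) * Real.exp (lam * (A + 4) * t) ≤
      (z0 + ε * lam * (A + 3) ^ 2 * t) * Real.exp (lam * (A + 4) * t) :=
    mul_le_mul_of_nonneg_right (by linarith only [hz0]) (Real.exp_pos _).le
  exact h.trans (h2.trans h3)

/-- **ACTIVE BRACKETS on any interval.** Conclusion (i) of `toda_active_core` (global brackets from the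
energy bootstrap, the σ-gate and positivity) holds on `[0,T]` for ANY `0 < T ≤ 1/2` — no `t₃ ≤ T` —
together with the crude Grönwall bound on the new bond `z' ≤ lam (A+4) z + ε lam (A+3)²`
(from `w ≤ A + 3`, `−y ≤ 1`, `z ≥ 0`). Needed for the a-priori bound (CoveringHyp (0)) on short
intervals. [folklore] -/
theorem toda_active_brackets :
    ∀ (lam ν ε A T : ℝ) (u v w z e y : ℝ → ℝ),
    1 < lam → lam ≤ 3 / 2 → ν = lam ^ (4 / 5 : ℝ) → 0 < ε → 0 < T → T ≤ 1 / 2 →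
    40000 ≤ A → -Real.log ε ≤ A / 5 → ε * (A + 2) ^ 2 ≤ 1 → Real.sqrt ε * A ≤ 1 / 40 →
    u 0 = A → v 0 = Real.sqrt ε → -ε ^ 2 ≤ w 0 → w 0 ≤ ε ^ (3 / 4 : ℝ) → 0 ≤ z 0 → z 0 ≤ ε ^ (3 / 2 : ℝ) →
    ContinuousOn u (Set.Icc 0 T) → ContinuousOn v (Set.Icc 0 T) → ContinuousOn w (Set.Icc 0 T) →
    ContinuousOn z (Set.Icc 0 T) → ContinuousOn e (Set.Icc 0 T) → ContinuousOn y (Set.Icc 0 T) →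
    (∀ t ∈ Set.Ico 0 T, HasDerivWithinAt u
      (-u t - v t ^ 2 + lam⁻¹ * e t ^ 2 - ε * u t * v t) (Set.Ici t) t) →
    (∀ t ∈ Set.Ico 0 T, HasDerivWithinAt v (v t * (u t - w t) - v t + ε * u t ^ 2) (Set.Ici t) t) →
    (∀ t ∈ Set.Ico 0 T, HasDerivWithinAt w
      (-ν * w t + v t ^ 2 - lam * z t ^ 2 - ε * lam * w t * z t) (Set.Ici t) t) →
    (∀ t ∈ Set.Ico 0 T, HasDerivWithinAt z
      (z t * (lam * (w t - y t) - ν) + ε * lam * w t ^ 2) (Set.Ici t) t) →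
    (∀ t ∈ Set.Icc 0 T, 0 ≤ e t ∧ e t ≤ 1) → (∀ t ∈ Set.Icc 0 T, |y t| ≤ 1) →
    (∀ t ∈ Set.Icc 0 T, z t ≤ 1) →
    ∀ t ∈ Set.Icc 0 T, (0 ≤ v t ∧ v t ≤ A + 3 ∧ -13 ≤ u t ∧ u t ≤ A + 3 ∧ -2 ≤ w t ∧ w t ≤ A + 3 ∧
      0 ≤ z t ∧ A / 4 ≤ Real.sqrt ((u t - w t) ^ 2 + 2 * v t ^ 2)) ∧
      z t ≤ (ε ^ (3 / 2 : ℝ) + ε * lam * (A + 3) ^ 2 * t) * Real.exp (lam * (A + 4) * t) := by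
  intro lam ν ε A T u v w z e y hlam1 hlam2 hν hε hT0 hT hA hΛ hεA hsεA hu0 hv0 hw0lo hw0hi
    hz0 hz0hi hu hv hw hz _ hy hu' hv' hw' hz' heb hyb hzb
  obtain ⟨hν1, hν2, hε2, hεA2, hεA1, hε4, hsε0, hsε1, h34, -, -, -, -⟩ :=
    shift_numerics hlam1 hlam2 hν hε hA hΛ hεA hsεA
  have hA0 : 0 < A := by linarith only [hA]
  have hlam0 : 0 < lam := by linarith only [hlam1]
  have hv0pos : 0 < v 0 := by rw [hv0]; exact hsε0
  -- z ≥ 0 and v ≥ 0 (variable-coefficient linear comparison with non-negative sources)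
  have hzv : ∀ t ∈ Icc 0 T, 0 ≤ z t ∧ 0 ≤ v t := fun t ht =>
    ⟨nonneg_of_mul_le_deriv_right (β := fun x => lam * (w x - y x) - ν) hz hz'
        ((continuousOn_const.mul (hw.sub hy)).sub continuousOn_const)
        (fun x _ => by
          have h1 : 0 ≤ ε * lam * w x ^ 2 := by positivity
          show (lam * (w x - y x) - ν) * z x ≤ _
          linarith only [h1]) hz0 ht,
      nonneg_of_mul_le_deriv_right (β := fun x => u x - w x - 1) hv hv'
        ((hu.sub hw).sub continuousOn_const)
        (fun x _ => by
          have h1 : 0 ≤ ε * u x ^ 2 := by positivity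
          show (u x - w x - 1) * v x ≤ _
          linarith only [h1]) (by rw [hv0]; exact hsε0.le) ht⟩
  -- the energy bound
  have hE : ∀ t ∈ Icc 0 T, u t ^ 2 + v t ^ 2 + w t ^ 2 ≤ A ^ 2 + 4 := by
    intro t ht
    have hE' : ∀ x ∈ Ico 0 T, HasDerivWithinAt (fun y => u y ^ 2 + v y ^ 2 + w y ^ 2)
        (2 * u x * (-u x - v x ^ 2 + lam⁻¹ * e x ^ 2 - ε * u x * v x) +
          2 * v x * (v x * (u x - w x) - v x + ε * u x ^ 2) +
          2 * w x * (-ν * w x + v x ^ 2 - lam * z x ^ 2 - ε * lam * w x * z x)) (Ici x) x :=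
      fun x hx => by
        refine ((((hu' x hx).fun_pow 2).add ((hv' x hx).fun_pow 2)).add
          ((hw' x hx).fun_pow 2)).congr_deriv ?_
        norm_num
    have h := sub_le_mul_of_deriv_right_le (f := fun y => u y ^ 2 + v y ^ 2 + w y ^ 2) (M := 4)
      (a := 0) (b := T)
      (((hu.fun_pow 2).add (hv.fun_pow 2)).add (hw.fun_pow 2)) hE' (fun x hx => by
        have hx' := Ico_subset_Icc_self hx
        exact shift_pt_energy hlam1 hlam2 hν1 hε (heb x hx').1 (heb x hx').2 (hzv x hx').1
          (hzb x hx')) t ht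
    have hsq : Real.sqrt ε ^ 2 = ε := Real.sq_sqrt hε.le
    have hw02 : w 0 ^ 2 ≤ 1 := by
      have h1 : -1 ≤ w 0 := by linarith only [hw0lo, hε2]
      have h2 : w 0 ≤ 1 := by linarith only [hw0hi, h34, sq_nonneg ε]
      nlinarith only [h1, h2]
    have e0 : u 0 ^ 2 + v 0 ^ 2 + w 0 ^ 2 ≤ A ^ 2 + 2 := by
      rw [hu0, hv0, hsq]; linarith only [hw02, hε4]
    simp only [sub_zero] at h
    linarith only [h, e0, ht.2, hT]
  -- sizes of the perturbations
  have hB : ∀ t ∈ Icc 0 T, |lam⁻¹ * e t ^ 2 - ε * u t * v t| ≤ 3 ∧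
      |-lam * z t ^ 2 - ε * lam * w t * z t| ≤ 3 ∧
      (0 ≤ ε * u t ^ 2 + ε ^ 2 * Real.exp (-ν * t) * v t ∧
        ε * u t ^ 2 + ε ^ 2 * Real.exp (-ν * t) * v t ≤ ε * (A + 2) ^ 2) ∧
      |u t| ≤ A + 1 ∧ v t ≤ A + 1 ∧ |w t| ≤ A + 1 := fun t ht =>
    shift_pt_pert hlam1 hlam2 hν1 hε hA hεA2 hεA1 ht.1 (hE t ht) (hzv t ht).2 (heb t ht).1
      (heb t ht).2 (hzv t ht).1 (hzb t ht)
  -- the shifted new carrier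
  set W : ℝ → ℝ := fun t => w t + ε ^ 2 * Real.exp (-ν * t) with hWdef
  have hWw : ∀ t, 0 ≤ t → w t ≤ W t ∧ W t ≤ w t + ε ^ 2 := fun t ht => by
    have h1 : Real.exp (-ν * t) ≤ 1 := Real.exp_le_one_iff.mpr (by nlinarith only [hν1, ht])
    have h2 : 0 ≤ ε ^ 2 * Real.exp (-ν * t) := by positivity
    have h3 : ε ^ 2 * Real.exp (-ν * t) ≤ ε ^ 2 * 1 := mul_le_mul_of_nonneg_left h1 (sq_nonneg ε)
    simp only [hWdef]
    constructor <;> linarith only [h2, h3]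
  have hWc : ContinuousOn W (Icc 0 T) := hw.add (by fun_prop)
  have hW0 : 0 ≤ W 0 ∧ W 0 ≤ 1 := by
    simp only [hWdef, mul_zero, Real.exp_zero, mul_one]
    constructor <;> linarith only [hw0lo, hw0hi, h34, hsε1]
  have hu'' : ∀ t ∈ Ico 0 T, HasDerivWithinAt u
      (-u t - v t ^ 2 + (lam⁻¹ * e t ^ 2 - ε * u t * v t)) (Ici t) t :=
    fun t ht => (hu' t ht).congr_deriv (by ring)
  have hv'' : ∀ t ∈ Ico 0 T, HasDerivWithinAt v
      (v t * (u t - W t) - v t + (ε * u t ^ 2 + ε ^ 2 * Real.exp (-ν * t) * v t)) (Ici t) t :=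
    fun t ht => (hv' t ht).congr_deriv (by simp only [hWdef]; ring)
  have hW' : ∀ t ∈ Ico 0 T, HasDerivWithinAt W
      (-ν * W t + v t ^ 2 + (-lam * z t ^ 2 - ε * lam * w t * z t)) (Ici t) t :=
    fun t ht => ((hw' t ht).add ((((hasDerivAt_id' t).const_mul (-ν)).exp.const_mul
      (ε ^ 2)).hasDerivWithinAt)).congr_deriv (by simp only [hWdef]; ring)
  -- the σ-gate lemma for (u, v, W) with P = 3 (no lower bound on T needed)
  have hν2' : ν ≤ 2 := by linarith only [hν2]
  have hA1 : 1000 * (1 + (3 : ℝ)) ≤ A := by linarith only [hA]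
  have hs3 : ∀ t ∈ Icc 0 T, 0 ≤ ε * u t ^ 2 + ε ^ 2 * Real.exp (-ν * t) * v t ∧
      ε * u t ^ 2 + ε ^ 2 * Real.exp (-ν * t) * v t ≤ 3 := fun t ht =>
    ⟨(hB t ht).2.2.1.1, (hB t ht).2.2.1.2.trans (by linarith only [hεA])⟩
  have hsig := toda_gate_sigma ν 3 T A u v W (fun t => lam⁻¹ * e t ^ 2 - ε * u t * v t)
    (fun t => -lam * z t ^ 2 - ε * lam * w t * z t)
    (fun t => ε * u t ^ 2 + ε ^ 2 * Real.exp (-ν * t) * v t)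
    hν1 hν2' (by norm_num) hT0 hT hA1 hu0 hW0.1 hW0.2 hv0pos (by rw [hv0]; linarith only [hsε1])
    hu hv hWc hu'' hv'' hW' (fun t ht => (hB t ht).1) (fun t ht => (hB t ht).2.1) hs3
  -- translation back to `w`
  have hRR : ∀ t, 0 ≤ t → |Real.sqrt ((u t - w t) ^ 2 + 2 * v t ^ 2) -
      Real.sqrt ((u t - W t) ^ 2 + 2 * v t ^ 2)| ≤ ε ^ 2 := fun t ht => by
    obtain ⟨h1, h2⟩ := hWw t ht
    have hc : 0 ≤ 2 * v t ^ 2 := by positivity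
    have e1 := gate_sqrt_shift_le (u t) (w t) (W t) (2 * v t ^ 2) hc
    have e2 := gate_sqrt_shift_le (u t) (W t) (w t) (2 * v t ^ 2) hc
    have hwW : |w t - W t| ≤ ε ^ 2 := by
      rw [abs_le]; constructor <;> linarith only [h1, h2]
    rw [abs_sub_comm] at e2
    rw [abs_le]
    constructor <;> linarith only [e1, e2, hwW]
  -- the crude Grönwall bound for `z`
  have hzG := brackets_z_gronwall (T := T) hlam0.le (by linarith only [hν1]) hε.le
    (by linarith only [hA]) hz hz' hyb (fun t ht => ((hB t ht).2.2.2.2.2).trans (by norm_num))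
    (fun t ht => (hzv t ht).1) hz0hi
  -- assembly
  intro t ht
  obtain ⟨hz0t, hv0t⟩ := hzv t ht
  obtain ⟨-, -, -, hub, hvb, hwb⟩ := hB t ht
  obtain ⟨-, hwlo, -, hSup, hR3, hσ⟩ := hsig t ht
  obtain ⟨hulo, -, hWlo, -, -⟩ := period_pt_apriori hν2 (ht.2.trans hT) hwlo hSup hσ
  obtain ⟨-, hw2⟩ := hWw t ht.1
  obtain ⟨hR1, -⟩ := abs_le.mp (hRR t ht.1)
  exact ⟨⟨hv0t, by linarith only [hvb], by linarith only [hulo],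
    by linarith only [le_abs_self (u t), hub], by linarith only [hWlo, hw2, hε2],
    by linarith only [le_abs_self (w t), hwb], hz0t, by linarith only [hR3, hR1, hε2, hA]⟩,
    hzG t ht⟩

end Summit.NavierStokesRegularity.NavierStokesRegularity.Theorems.PerpetualPumpCircuitPump
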